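import Mathlib.ModelTheory.Order
import Mathlib.Analysis.Real.Cardinality
import Literature.NumberTheory.Transcendental.ZilberField
import HarnessLib

/-!
# Quasiminimality and the standard kernel: basic API for two predicates of `ZilberField.lean`

`FirstOrder.Language.IsQuasiminimal L M` (defined in
`Literature.NumberTheory.Transcendental.ZilberField`) is the *predicate* "every subset of `M`
definable in `L` with parameters from `M` is countable or co-countable" (Zilber 2005 §1;
Bays–Kirby 2018, Conjecture 1.1: "quasiminimal, that is, every subset of `ℂ` definable in `ℂ_exp`
is either countable or co-countable"). It is a definition, not a named fact: there is no
`IsQuasiminimal_holds`. This file records the two elementary facts delimiting it: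

* `FirstOrder.Language.IsQuasiminimal.of_countable`: countable structures are (vacuously)
  quasiminimal;
* `FirstOrder.Language.not_isQuasiminimal_real_order`: the real order `(ℝ, ≤)` is not
  quasiminimal (`[0, ∞)` is definable from the parameter `0`, and it and its complement have
  cardinality `𝔠`), so quasiminimality fails in general — the standard example that ordered
  structures are not (quasi)minimal (Pila 2022, §6, p. 60).

Kept in a sibling file so that `ZilberField.lean` does not import `Mathlib.ModelTheory.Order` and
`Mathlib.Analysis.Real.Cardinality`.

A second section does the same for the standard-kernel axiom `Literature.HasStandardKernel K` (Zilber
2005 §1; Kirby 2013 §2, axiom 2), likewise a predicate and not a named fact: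
`Literature.NumberTheory.Transcendental.HasStandardKernel.expKernel_ne_bot`, `Literature.NumberTheory.Transcendental.HasStandardKernel.infinite_expKernel` (the kernel
is infinite, Kirby's literal wording), `Literature.NumberTheory.Transcendental.not_hasStandardKernel_of_expKernel_eq_bot` and
`Literature.NumberTheory.Transcendental.not_hasStandardKernel_real` (`ℝ_exp` fails the axiom). The positive instance `ℂ_exp` is the
named fact `Literature.NumberTheory.Transcendental.hasStandardKernel_complex` (`Zilber.lean`), discharged in `ZilberProofs.lean`.

A third section proves that the standard-kernel axiom is invariant under isomorphisms of
exponential fields (`Literature.NumberTheory.Transcendental.ExponentialRingEquiv.exp_apply_eq_one_iff`,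
`Literature.NumberTheory.Transcendental.ExponentialRingEquiv.mem_expKernel_iff_symm`,
`Literature.NumberTheory.Transcendental.HasStandardKernel.of_exponentialRingEquiv`,
`Literature.NumberTheory.Transcendental.ExponentialRingEquiv.hasStandardKernel_iff`): the
`HasStandardKernel` component of transporting `IsZilberField` along an `ExponentialRingEquiv`.

## References

* B. Zilber, *Pseudo-exponentiation on algebraically closed fields of characteristic zero*,
  Ann. Pure Appl. Logic 132 (2005) 67–95, §1.
* M. Bays, J. Kirby, *Pseudo-exponential maps, variants, and quasiminimality*, Algebra & Number
  Theory 12 (2018) 493–549 (arXiv:1512.04262), Conjecture 1.1.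
* J. Pila, *Point-Counting and the Zilber–Pink Conjecture*, CUP 2022, p. 60.
* J. Kirby, *A note on the axioms for Zilber's pseudo-exponential fields*, Notre Dame J. Formal
  Logic 54 (2013) 509–520 (arXiv:1006.0894), §2 axiom 2 (p. 4), §2.5 (p. 5).
-/

open FirstOrder FirstOrder.Language Set Cardinal

namespace FirstOrder.Language

variable {L : Language} {M : Type*} [L.Structure M]

/-- Countable structures are (vacuously) quasiminimal: every subset is countable. [folklore] -/
theorem IsQuasiminimal.of_countable [Countable M] : L.IsQuasiminimal M :=
  fun s _ => Or.inl s.to_countable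

/-- Quasiminimality is a genuine condition, not a theorem about all structures: the real order
`(ℝ, ≤)` (as a `Language.order`-structure via Mathlib's `orderStructure`) is not quasiminimal,
since the set `[0, ∞)`, definable from the parameter `0`, and its complement `(-∞, 0)` both have
cardinality `𝔠 > ℵ₀`. This is the standard observation that (quasi)minimality fails for ordered
structures (Pila 2022, p. 60: "an interval and its complement are typically both infinite").
[cite: Pila2022, p. 60] -/
theorem not_isQuasiminimal_real_order :
    ¬ @IsQuasiminimal Language.order ℝ (orderStructure ℝ) := by
  letI := orderStructure ℝ
  haveI : Language.order.OrderedStructure ℝ := ⟨fun _ => Iff.rfl⟩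
  intro h
  have hdef : (univ : Set ℝ).Definable₁ Language.order (Ici (0 : ℝ)) := by
    unfold Set.Definable₁
    rw [Set.definable_iff_exists_formula_sum]
    refine ⟨(var (Sum.inl (Sum.inl ⟨0, mem_univ _⟩))).le (var (Sum.inl (Sum.inr 0))), ?_⟩
    ext x
    simp [Formula.Realize]
  have hunc : ∀ t : Set ℝ, #t = 𝔠 → ¬ t.Countable := by
    intro t ht hc
    have hle : 𝔠 ≤ ℵ₀ := ht ▸ Cardinal.mk_le_aleph0_iff.mpr hc.to_subtype
    exact Cardinal.aleph0_lt_continuum.not_ge hle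
  rcases h _ hdef with hc | hc
  · exact hunc _ (Cardinal.mk_Ici_real 0) hc
  · rw [compl_Ici] at hc
    exact hunc _ (Cardinal.mk_Iio_real 0) hc

end FirstOrder.Language

/-! ### The standard kernel axiom

`Literature.HasStandardKernel K` (`ZilberField.lean`) is Zilber's axiom "`ker = ωℤ`, `ω` transcendental"
(Zilber 2005 §1; Kirby 2013 §2, axiom 2, p. 4: "Standard kernel: the kernel of the exponential map
is an infinite cyclic group generated by a transcendental element `τ`"). Like quasiminimality it
is a *predicate* on exponential fields — one of the axioms of a Zilber field — not a named fact:
there is no `HasStandardKernel_holds`. It holds in `ℂ_exp` (`Literature.NumberTheory.Transcendental.hasStandardKernel_complex`,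
discharged in `ZilberProofs.lean` from Lindemann's theorem) and fails in `ℝ_exp`
(`Literature.NumberTheory.Transcendental.not_hasStandardKernel_real` below). We also record that the vendored form (`ker exp = τℤ`
with `τ` transcendental) yields Kirby's literal wording "infinite cyclic": `τ ≠ 0`, so `τℤ` is
infinite in characteristic zero (`Literature.NumberTheory.Transcendental.HasStandardKernel.infinite_expKernel`). -/

namespace Literature.NumberTheory.Transcendental

variable {K : Type*} [Field K] [CharZero K] [Literature.ModelTheory.ExponentialFields.ExponentialRing K]

/-- A standard kernel is non-trivial: its generator `τ` is transcendental, hence non-zero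
(Kirby 2013 §2, axiom 2: the kernel is *infinite* cyclic). [cite: Kirby2013Axioms, §2 axiom 2, p. 4] -/
theorem HasStandardKernel.expKernel_ne_bot (h : HasStandardKernel K) :
    Literature.ModelTheory.ExponentialFields.ExponentialRing.expKernel K ≠ ⊥ := by
  obtain ⟨τ, hτ, hker⟩ := h
  intro hbot
  have hmem : τ ∈ Literature.ModelTheory.ExponentialFields.ExponentialRing.expKernel K := hker ▸ AddSubgroup.mem_zmultiples τ
  rw [hbot, AddSubgroup.mem_bot] at hmem
  exact hτ (hmem ▸ isAlgebraic_zero)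

/-- The vendored axiom implies Kirby's literal formulation "the kernel of the exponential map is an
*infinite* cyclic group generated by a transcendental element `τ`" (Kirby 2013 §2, axiom 2,
p. 4): `n ↦ nτ` is injective because `τ ≠ 0` and `K` has characteristic zero. [cite: Kirby2013Axioms, §2 axiom 2, p. 4] -/
theorem HasStandardKernel.infinite_expKernel (h : HasStandardKernel K) :
    (Literature.ModelTheory.ExponentialFields.ExponentialRing.expKernel K : Set K).Infinite := by
  obtain ⟨τ, hτ, hker⟩ := h
  have hτ0 : τ ≠ 0 := fun h0 => hτ (h0 ▸ isAlgebraic_zero)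
  have hinj : Function.Injective fun n : ℤ => (n : K) * τ := fun m n hmn =>
    Int.cast_injective (mul_right_cancel₀ hτ0 hmn)
  refine Set.infinite_of_injective_forall_mem hinj fun n => ?_
  rw [hker, SetLike.mem_coe, AddSubgroup.mem_zmultiples_iff]
  exact ⟨n, by rw [zsmul_eq_mul]⟩

/-- An exponential field whose exponential map has trivial kernel does not have standard kernel.
[cite: Kirby2013Axioms, §2 axiom 2, p. 4] -/
theorem not_hasStandardKernel_of_expKernel_eq_bot (h : Literature.ModelTheory.ExponentialFields.ExponentialRing.expKernel K = ⊥) :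
    ¬ HasStandardKernel K :=
  fun hK => hK.expKernel_ne_bot h

/-- The standard-kernel axiom is a genuine axiom, not a theorem about all exponential fields: the
real exponential field `ℝ_exp` fails it, since `ker (Real.exp) = {0}`
(`Literature.ModelTheory.ExponentialFields.ExponentialRing.expKernel_real`, from Mathlib's `Real.exp_eq_one_iff`). Consequently no
unconditional `HasStandardKernel_holds` exists; the instance asserted in the literature is
`ℂ_exp` (Kirby 2013 §2.5, p. 5: "Axioms 1 and 2 are chosen such that `ℂ_exp` satisfies them"),
see `Literature.NumberTheory.Transcendental.hasStandardKernel_complex`. [cite: Kirby2013Axioms, §2 axiom 2, p. 4, and §2.5, p. 5] -/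
theorem not_hasStandardKernel_real : ¬ HasStandardKernel ℝ :=
  not_hasStandardKernel_of_expKernel_eq_bot Literature.ModelTheory.ExponentialFields.ExponentialRing.expKernel_real

end Literature.NumberTheory.Transcendental

/-! ### Transport of the standard kernel along isomorphisms of exponential fields

Zilber's axioms are properties of the isomorphism type of an exponential field (Zilber 2005,
Thm 1.1 classifies the models up to E-ring isomorphism; Kirby 2013 §2). For the standard-kernel
axiom this is the elementary computation below: an E-ring isomorphism `e : K ≃ K'` satisfies
`exp (e x) = 1 ↔ exp x = 1`, so it maps `ker exp_K = τℤ` onto `ker exp_{K'} = e(τ)ℤ`, and `e τ` is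
transcendental because `e` is a `ℚ`-algebra isomorphism. This is the `HasStandardKernel` component
of the transport of `IsZilberField` along `ExponentialRingEquiv` used in the isomorphism form of
Zilber's conjecture (`Literature.NumberTheory.Transcendental.zilberConjecture_iff_forall_nonempty_equiv`). -/

namespace Literature.NumberTheory.Transcendental

section Transport

variable {K K' : Type*} [Field K] [CharZero K] [Literature.ModelTheory.ExponentialFields.ExponentialRing K]
  [Field K'] [CharZero K'] [Literature.ModelTheory.ExponentialFields.ExponentialRing K']

omit [CharZero K] [CharZero K'] in
/-- An isomorphism of exponential rings identifies the kernels of the exponential maps: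
`exp (e x) = 1 ↔ exp x = 1` (apply `e` to `exp x` and use `e (exp x) = exp (e x)`, `e` injective). [folklore] -/
theorem ExponentialRingEquiv.exp_apply_eq_one_iff (e : ExponentialRingEquiv K K') (x : K) :
    Literature.ModelTheory.ExponentialFields.ExponentialRing.exp (e x) = 1 ↔
      Literature.ModelTheory.ExponentialFields.ExponentialRing.exp x = 1 := by
  rw [← e.map_exp, map_eq_one_iff e e.injective]

omit [CharZero K] [CharZero K'] in
/-- An isomorphism of exponential rings maps the kernel of `exp` onto the kernel of `exp`:
`x ∈ ker exp_{K'} ↔ e⁻¹ x ∈ ker exp_K`. [folklore] -/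
theorem ExponentialRingEquiv.mem_expKernel_iff_symm (e : ExponentialRingEquiv K K') (x : K') :
    x ∈ Literature.ModelTheory.ExponentialFields.ExponentialRing.expKernel K' ↔
      e.symm x ∈ Literature.ModelTheory.ExponentialFields.ExponentialRing.expKernel K := by
  rw [Literature.ModelTheory.ExponentialFields.ExponentialRing.mem_expKernel_iff,
    Literature.ModelTheory.ExponentialFields.ExponentialRing.mem_expKernel_iff,
    ← e.exp_apply_eq_one_iff, e.apply_symm_apply]

/-- **The standard-kernel axiom is invariant under isomorphisms of exponential fields**: if
`ker exp_K = τℤ` with `τ` transcendental and `e : K ≃ K'` is an E-ring isomorphism, then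
`ker exp_{K'} = e(τ)ℤ` with `e τ` transcendental (a ring isomorphism of characteristic-zero fields
is a `ℚ`-algebra isomorphism, so it preserves transcendence over `ℚ`). Zilber's axioms describe
exponential fields up to isomorphism (Zilber 2005, Thm 1.1; Kirby 2013 §2, axiom 2). [folklore] -/
theorem HasStandardKernel.of_exponentialRingEquiv (e : ExponentialRingEquiv K K')
    (h : HasStandardKernel K) : HasStandardKernel K' := by
  obtain ⟨τ, hτ, hker⟩ := h
  refine ⟨e τ, ?_, ?_⟩
  · -- `e` is an injective `ℚ`-algebra homomorphism, hence reflects algebraicity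
    have hf : Function.Injective e.toRingEquiv.toRingHom.toRatAlgHom := e.injective
    exact fun halg => hτ ((isAlgebraic_algHom_iff _ hf).mp halg)
  · ext x
    rw [e.mem_expKernel_iff_symm, hker, AddSubgroup.mem_zmultiples_iff,
      AddSubgroup.mem_zmultiples_iff]
    constructor
    · rintro ⟨n, hn⟩
      refine ⟨n, ?_⟩
      rw [← map_zsmul e, hn, e.apply_symm_apply]
    · rintro ⟨n, rfl⟩
      exact ⟨n, by rw [← map_zsmul e, e.symm_apply_apply]⟩

/-- The standard-kernel axiom is a property of the isomorphism type: `K` has standard kernel iff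
`K'` does, for `e : K ≃ K'` an E-ring isomorphism. [folklore] -/
theorem ExponentialRingEquiv.hasStandardKernel_iff (e : ExponentialRingEquiv K K') :
    HasStandardKernel K ↔ HasStandardKernel K' :=
  ⟨HasStandardKernel.of_exponentialRingEquiv e, HasStandardKernel.of_exponentialRingEquiv e.symm⟩

end Transport

end Literature.NumberTheory.Transcendental
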